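import Mathlib
import Summits.Ventures.PercRepro2.CoinChainBernstein
import Summits.Ventures.PercRepro2.CoinChainPivotalCov

/-!
# The GENERAL AND-switch chain from ONE new coin-free inequality (XA) and (Q′)
(blind cell PercRepro2, night-2 g25; proofs/NIGHT2-DARC.md §65)

Notation as in `chain_functional_nonneg_of_bernstein`: `a0 a1 a2` the moments of the coin-closed
`R`-law `R⁰ = ν·chainMix ent ent' 0 c d`, `b0 b1 b2` those of `R¹`, `e` those of the coin-closed
gate `G⁰`, `g` those of `G¹`; `U(i,j,k)` the eight mixed-centre functionals and
`Δ = (b0 a1 − a0 b1)(b0 a2 − a0 b2)` the cleared product of the two world shifts.  With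
`X = U110/b0²` (the coin-closed gate at the world-1 means), `A₁₀ = U001/a0²`, `A₁₁ = U111/b0²`,
`A₀₀ = U000/a0²` and `ε φ = Δ/(a0 b0)²`, the two Bernstein coefficients of the chain cubic are
EXACTLY (`chain_b1_identity`, `chain_b2_identity`)

  `3b₁ = a0 b0 [A₀₀ + X − e0 ε φ] + a0² A₁₀`,   `3b₂ = b0² X + a0 b0 [A₁₀ + A₁₁ − g0 ε φ]`,

so the chain holds at every `ρ ∈ [0, 1]` as soon as (`chain_bernstein_of_XA_Qprime`)

  (XA)  `a0²·U110 + a0 b0·U001 − e0·Δ ≥ 0`     (`X + (a0/b0) A₁₀ ≥ e0 ε φ`)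
  (Q′)  `a0²·U111 + (b0 − g0)·Δ ≥ 0`            (g24's (Q′), with `R⁰` as the world-0 law),

together with the kernel facts `U000, U111 ≥ 0`, `e0 ≤ a0`, `b0 ≤ a0` and
`a0 − e0 ≤ b0 − g0` (the world-1 pivotal mass dominates the world-0 one) — all termwise.
`b₁`: `a0 b0·3b₁ = b0² U000 + (XA)`.  `b₂`: `a0² b0·3b₂ = b0·(XA) + a0³ U111 + (b0 e0 − a0 g0) Δ`;
for `Δ ≥ 0` the last coefficient is `≥ 0` (`b0 e0 ≥ a0 g0`), for `Δ < 0` it is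
`a0·(Q′) + b0 (e0 − a0) Δ ≥ 0`.  `chain_functional_nonneg_of_XA_Qprime` is the chain theorem.
Census of (XA) on the abstract kernel class: 0 / 16,800 failures (n = 3, 4, 5; point and up-set
markers), worst ratio 0.33 (mining/night-2/g25/xa.py).
-/

namespace Summit.Ventures.PercRepro2.Coin

section XAIdentities

variable {R : Type*} [CommRing R]

/-- `a0 b0 (U100 + U010) = b0² U000 + a0² U110 − e0 Δ`: the two one-centre-from-each-world
functionals of the coin-closed gate are the world-0 and the world-1 centrings minus the shift
product (a ring identity in the moments). -/
theorem chain_b1_identity (a0 a1 a2 b0 b1 b2 e0 e1 e2 e12 : R) :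
    a0 * b0 * ((b0 * a0 * e12 - b0 * a2 * e1 - a0 * b1 * e2 + b1 * a2 * e0)
          + (a0 * b0 * e12 - a0 * b2 * e1 - b0 * a1 * e2 + a1 * b2 * e0)) =
      b0 * b0 * (a0 * a0 * e12 - a0 * a2 * e1 - a0 * a1 * e2 + a1 * a2 * e0)
        + a0 * a0 * (b0 * b0 * e12 - b0 * b2 * e1 - b0 * b1 * e2 + b1 * b2 * e0)
        - e0 * ((b0 * a1 - a0 * b1) * (b0 * a2 - a0 * b2)) := by
  ring

/-- `a0 b0 (U101 + U011) = b0² U001 + a0² U111 − g0 Δ`: the same identity for the coin-open gate. -/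
theorem chain_b2_identity (a0 a1 a2 b0 b1 b2 g0 g1 g2 g12 : R) :
    a0 * b0 * ((b0 * a0 * g12 - b0 * a2 * g1 - a0 * b1 * g2 + b1 * a2 * g0)
          + (a0 * b0 * g12 - a0 * b2 * g1 - b0 * a1 * g2 + a1 * b2 * g0)) =
      b0 * b0 * (a0 * a0 * g12 - a0 * a2 * g1 - a0 * a1 * g2 + a1 * a2 * g0)
        + a0 * a0 * (b0 * b0 * g12 - b0 * b2 * g1 - b0 * b1 * g2 + b1 * b2 * g0)
        - g0 * ((b0 * a1 - a0 * b1) * (b0 * a2 - a0 * b2)) := by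
  ring

end XAIdentities

section XAAlg

variable {R : Type*} [Field R] [LinearOrder R] [IsStrictOrderedRing R]

/-- **The Bernstein coefficients `b₁, b₂` from (XA) and (Q′).**  Masses: `0 < a0`, `0 < b0`,
`e0 ≤ a0`, `b0 ≤ a0`, `a0 − e0 ≤ b0 − g0`; the kernel facts `U000, U111 ≥ 0`;
`hXA`: `a0² U110 + a0 b0 U001 − e0 Δ ≥ 0`; `hQ`: `a0² U111 + (b0 − g0) Δ ≥ 0`.  Then
`U100 + U010 + U001 ≥ 0` and `U110 + U101 + U011 ≥ 0`. -/
theorem chain_bernstein_of_XA_Qprime (a0 a1 a2 b0 b1 b2 e0 e1 e2 e12 g0 g1 g2 g12 : R)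
    (ha0 : 0 < a0) (hb0 : 0 < b0) (he0 : e0 ≤ a0) (hba : b0 ≤ a0) (hP : a0 - e0 ≤ b0 - g0)
    (hU000 : 0 ≤ a0 * a0 * e12 - a0 * a2 * e1 - a0 * a1 * e2 + a1 * a2 * e0)
    (hU111 : 0 ≤ b0 * b0 * g12 - b0 * b2 * g1 - b0 * b1 * g2 + b1 * b2 * g0)
    (hXA : 0 ≤ a0 ^ 2 * (b0 * b0 * e12 - b0 * b2 * e1 - b0 * b1 * e2 + b1 * b2 * e0)
        + a0 * b0 * (a0 * a0 * g12 - a0 * a2 * g1 - a0 * a1 * g2 + a1 * a2 * g0)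
        - e0 * ((b0 * a1 - a0 * b1) * (b0 * a2 - a0 * b2)))
    (hQ : 0 ≤ a0 ^ 2 * (b0 * b0 * g12 - b0 * b2 * g1 - b0 * b1 * g2 + b1 * b2 * g0)
        + (b0 - g0) * ((b0 * a1 - a0 * b1) * (b0 * a2 - a0 * b2))) :
    (0 ≤ (b0 * a0 * e12 - b0 * a2 * e1 - a0 * b1 * e2 + b1 * a2 * e0)
          + (a0 * b0 * e12 - a0 * b2 * e1 - b0 * a1 * e2 + a1 * b2 * e0)
          + (a0 * a0 * g12 - a0 * a2 * g1 - a0 * a1 * g2 + a1 * a2 * g0)) ∧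
    (0 ≤ (b0 * b0 * e12 - b0 * b2 * e1 - b0 * b1 * e2 + b1 * b2 * e0)
          + (b0 * a0 * g12 - b0 * a2 * g1 - a0 * b1 * g2 + b1 * a2 * g0)
          + (a0 * b0 * g12 - a0 * b2 * g1 - b0 * a1 * g2 + a1 * b2 * g0)) := by
  set U000 := a0 * a0 * e12 - a0 * a2 * e1 - a0 * a1 * e2 + a1 * a2 * e0 with hU000def
  set U110 := b0 * b0 * e12 - b0 * b2 * e1 - b0 * b1 * e2 + b1 * b2 * e0 with hU110def
  set U001 := a0 * a0 * g12 - a0 * a2 * g1 - a0 * a1 * g2 + a1 * a2 * g0 with hU001def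
  set U111 := b0 * b0 * g12 - b0 * b2 * g1 - b0 * b1 * g2 + b1 * b2 * g0 with hU111def
  set U100 := b0 * a0 * e12 - b0 * a2 * e1 - a0 * b1 * e2 + b1 * a2 * e0 with hU100def
  set U010 := a0 * b0 * e12 - a0 * b2 * e1 - b0 * a1 * e2 + a1 * b2 * e0 with hU010def
  set U101 := b0 * a0 * g12 - b0 * a2 * g1 - a0 * b1 * g2 + b1 * a2 * g0 with hU101def
  set U011 := a0 * b0 * g12 - a0 * b2 * g1 - b0 * a1 * g2 + a1 * b2 * g0 with hU011def
  set Δ := (b0 * a1 - a0 * b1) * (b0 * a2 - a0 * b2) with hΔdef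
  have hab : 0 < a0 * b0 := mul_pos ha0 hb0
  have hid1 : a0 * b0 * (U100 + U010) = b0 * b0 * U000 + a0 * a0 * U110 - e0 * Δ :=
    chain_b1_identity a0 a1 a2 b0 b1 b2 e0 e1 e2 e12
  have hid2 : a0 * b0 * (U101 + U011) = b0 * b0 * U001 + a0 * a0 * U111 - g0 * Δ :=
    chain_b2_identity a0 a1 a2 b0 b1 b2 g0 g1 g2 g12
  constructor
  · -- `a0 b0 · 3b₁ = b0² U000 + (XA)`
    have key : 0 ≤ a0 * b0 * (U100 + U010 + U001) := by
      have e : a0 * b0 * (U100 + U010 + U001) = b0 * b0 * U000 +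
          (a0 ^ 2 * U110 + a0 * b0 * U001 - e0 * Δ) := by
        rw [show a0 * b0 * (U100 + U010 + U001) = a0 * b0 * (U100 + U010) + a0 * b0 * U001 by ring,
          hid1]; ring
      rw [e]
      exact add_nonneg (mul_nonneg (mul_nonneg hb0.le hb0.le) hU000) hXA
    exact (mul_nonneg_iff_of_pos_left hab).mp key
  · -- `a0² b0 · 3b₂ = b0·(XA) + a0³ U111 + (b0 e0 − a0 g0) Δ`
    have hab2 : 0 < a0 ^ 2 * b0 := mul_pos (pow_pos ha0 2) hb0
    have key : 0 ≤ a0 ^ 2 * b0 * (U110 + U101 + U011) := by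
      have e : a0 ^ 2 * b0 * (U110 + U101 + U011) =
          b0 * (a0 ^ 2 * U110 + a0 * b0 * U001 - e0 * Δ) + a0 ^ 3 * U111 + (b0 * e0 - a0 * g0) * Δ := by
        have : a0 ^ 2 * b0 * (U110 + U101 + U011) = a0 * (a0 * b0 * U110) + a0 * (a0 * b0 * (U101 + U011)) := by
          ring
        rw [this, hid2]; ring
      rw [e]
      have h1 : 0 ≤ b0 * (a0 ^ 2 * U110 + a0 * b0 * U001 - e0 * Δ) := mul_nonneg hb0.le hXA
      have hge : a0 * g0 ≤ b0 * e0 := by nlinarith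
      rcases le_or_gt 0 Δ with hΔ | hΔ
      · have h2 : 0 ≤ a0 ^ 3 * U111 := mul_nonneg (pow_nonneg ha0.le 3) hU111
        have h3 : 0 ≤ (b0 * e0 - a0 * g0) * Δ := mul_nonneg (by linarith) hΔ
        linarith
      · have e2 : a0 ^ 3 * U111 + (b0 * e0 - a0 * g0) * Δ =
            a0 * (a0 ^ 2 * U111 + (b0 - g0) * Δ) + b0 * ((e0 - a0) * Δ) := by ring
        have h2 : 0 ≤ a0 * (a0 ^ 2 * U111 + (b0 - g0) * Δ) := mul_nonneg ha0.le hQ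
        have h3 : 0 ≤ b0 * ((e0 - a0) * Δ) :=
          mul_nonneg hb0.le (mul_nonneg_of_nonpos_of_nonpos (by linarith) hΔ.le)
        linarith
    exact (mul_nonneg_iff_of_pos_left hab2).mp key

end XAAlg

section XAChain

variable {V : Type*} [DecidableEq V] {R : Type*} [Field R] [LinearOrder R] [IsStrictOrderedRing R]

omit [IsStrictOrderedRing R] in
/-- The coin-closed value is at least the coin-open one (`d ≤ c`). -/
lemma chainMix_one_le_zero (ent ent' : Finset V) {c d : Finset V → R} (hdc : ∀ W, d W ≤ c W)
    (W : Finset V) : chainMix ent ent' 1 c d W ≤ chainMix ent ent' 0 c d W := by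
  unfold chainMix chainTheta
  by_cases h0 : ∃ r ∈ ent, r ∈ W
  · simp [h0]
  · by_cases h1 : ∃ r ∈ ent', r ∈ W
    · simp [h0, h1, hdc W]
    · simp [h0, h1]

/-- The coin-closed pivotal value is at most the coin-open one (`d' ≤ d`). -/
lemma chainMix_sub_zero_le_one (ent ent' : Finset V) {c d d' : Finset V → R}
    (hd'd : ∀ W, d' W ≤ d W) (W : Finset V) :
    chainMix ent ent' 0 c d W - chainMix ent ent' 0 c d' W ≤
      chainMix ent ent' 1 c d W - chainMix ent ent' 1 c d' W := by
  unfold chainMix chainTheta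
  by_cases h0 : ∃ r ∈ ent, r ∈ W
  · simp [h0]
  · by_cases h1 : ∃ r ∈ ent', r ∈ W
    · simp [h0, h1, hd'd W]
    · simp [h0, h1]

/-- **THE GENERAL AND-SWITCH CHAIN AT EVERY COIN PROBABILITY FROM (XA) AND (Q′).**
`R⁰ = ν·chainMix ent ent' 0 c d`, `R¹ = ν·chainMix ent ent' 1 c d`, `G⁰ = ν·chainMix ent ent' 0 c d'`,
`G¹ = ν·chainMix ent ent' 1 c d'`; the head hypotheses of `chain_world1_nonneg`, `d' ≤ d`,
nonnegative increasing markers, positive world masses, and the two coin-free inequalities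
`hXA` (`a0² U110 + a0 b0 U001 − e0 Δ ≥ 0`) and `hQ` (`a0² U111 + (b0 − g0) Δ ≥ 0`).  Then the
chain functional at every `ρ ∈ [0, 1]` is nonnegative. -/
theorem chain_functional_nonneg_of_XA_Qprime (U ent ent' : Finset V) (ν c d d' : Finset V → R)
    (ρ : R) (hρ0 : 0 ≤ ρ) (hρ1 : ρ ≤ 1) (hν0 : ∀ W, 0 ≤ ν W)
    (hν : ∀ s ⊆ U, ∀ t ⊆ U, ν s * ν t ≤ ν (s ∩ t) * ν (s ∪ t))
    (hc0 : ∀ W, 0 ≤ c W) (hd0 : ∀ W, 0 ≤ d W) (hd'0 : ∀ W, 0 ≤ d' W)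
    (hdc : ∀ W, d W ≤ c W) (hd'c : ∀ W, d' W ≤ c W) (hd'd : ∀ W, d' W ≤ d W)
    (hcc : ∀ s t, c s * c t ≤ c (s ∩ t) * c (s ∪ t))
    (hdd : ∀ s t, d s * d t ≤ d (s ∩ t) * d (s ∪ t))
    (hd'd' : ∀ s t, d' s * d' t ≤ d' (s ∩ t) * d' (s ∪ t))
    (hcd : ∀ s t, c s * d t ≤ c (s ∩ t) * d (s ∪ t))
    (hcd' : ∀ s t, c s * d' t ≤ c (s ∩ t) * d' (s ∪ t))
    (hdd' : ∀ s t, d s * d' t ≤ d (s ∩ t) * d' (s ∪ t))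
    (hratio : ∀ s t, s ⊆ t → d s * c t ≤ c s * d t)
    (hratio' : ∀ s t, s ⊆ t → d' s * c t ≤ c s * d' t)
    (x y : Finset V → R) (hx0 : ∀ W, 0 ≤ x W) (hy0 : ∀ W, 0 ≤ y W)
    (hxm : ∀ s t, x s ≤ x (s ∪ t)) (hym : ∀ s t, y s ≤ y (s ∪ t))
    (hpos0 : 0 < ∑ W ∈ U.powerset, ν W * chainMix ent ent' 0 c d W)
    (hpos1 : 0 < ∑ W ∈ U.powerset, ν W * chainMix ent ent' 1 c d W)
    (hXA : 0 ≤ (∑ W ∈ U.powerset, ν W * chainMix ent ent' 0 c d W) ^ 2 *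
          ((∑ W ∈ U.powerset, ν W * chainMix ent ent' 1 c d W) *
            (∑ W ∈ U.powerset, ν W * chainMix ent ent' 1 c d W) *
            (∑ W ∈ U.powerset, ν W * chainMix ent ent' 0 c d' W * (x W * y W))
          - (∑ W ∈ U.powerset, ν W * chainMix ent ent' 1 c d W) *
            (∑ W ∈ U.powerset, ν W * chainMix ent ent' 1 c d W * y W) *
            (∑ W ∈ U.powerset, ν W * chainMix ent ent' 0 c d' W * x W)
          - (∑ W ∈ U.powerset, ν W * chainMix ent ent' 1 c d W) *
            (∑ W ∈ U.powerset, ν W * chainMix ent ent' 1 c d W * x W) *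
            (∑ W ∈ U.powerset, ν W * chainMix ent ent' 0 c d' W * y W)
          + (∑ W ∈ U.powerset, ν W * chainMix ent ent' 1 c d W * x W) *
            (∑ W ∈ U.powerset, ν W * chainMix ent ent' 1 c d W * y W) *
            (∑ W ∈ U.powerset, ν W * chainMix ent ent' 0 c d' W))
        + (∑ W ∈ U.powerset, ν W * chainMix ent ent' 0 c d W) *
          (∑ W ∈ U.powerset, ν W * chainMix ent ent' 1 c d W) *
          ((∑ W ∈ U.powerset, ν W * chainMix ent ent' 0 c d W) *
            (∑ W ∈ U.powerset, ν W * chainMix ent ent' 0 c d W) *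
            (∑ W ∈ U.powerset, ν W * chainMix ent ent' 1 c d' W * (x W * y W))
          - (∑ W ∈ U.powerset, ν W * chainMix ent ent' 0 c d W) *
            (∑ W ∈ U.powerset, ν W * chainMix ent ent' 0 c d W * y W) *
            (∑ W ∈ U.powerset, ν W * chainMix ent ent' 1 c d' W * x W)
          - (∑ W ∈ U.powerset, ν W * chainMix ent ent' 0 c d W) *
            (∑ W ∈ U.powerset, ν W * chainMix ent ent' 0 c d W * x W) *
            (∑ W ∈ U.powerset, ν W * chainMix ent ent' 1 c d' W * y W)
          + (∑ W ∈ U.powerset, ν W * chainMix ent ent' 0 c d W * x W) *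
            (∑ W ∈ U.powerset, ν W * chainMix ent ent' 0 c d W * y W) *
            (∑ W ∈ U.powerset, ν W * chainMix ent ent' 1 c d' W))
        - (∑ W ∈ U.powerset, ν W * chainMix ent ent' 0 c d' W) *
          (((∑ W ∈ U.powerset, ν W * chainMix ent ent' 1 c d W) *
              (∑ W ∈ U.powerset, ν W * chainMix ent ent' 0 c d W * x W)
            - (∑ W ∈ U.powerset, ν W * chainMix ent ent' 0 c d W) *
              (∑ W ∈ U.powerset, ν W * chainMix ent ent' 1 c d W * x W)) *
           ((∑ W ∈ U.powerset, ν W * chainMix ent ent' 1 c d W) *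
              (∑ W ∈ U.powerset, ν W * chainMix ent ent' 0 c d W * y W)
            - (∑ W ∈ U.powerset, ν W * chainMix ent ent' 0 c d W) *
              (∑ W ∈ U.powerset, ν W * chainMix ent ent' 1 c d W * y W))))
    (hQ : 0 ≤ (∑ W ∈ U.powerset, ν W * chainMix ent ent' 0 c d W) ^ 2 *
          ((∑ W ∈ U.powerset, ν W * chainMix ent ent' 1 c d W) *
            (∑ W ∈ U.powerset, ν W * chainMix ent ent' 1 c d W) *
            (∑ W ∈ U.powerset, ν W * chainMix ent ent' 1 c d' W * (x W * y W))
          - (∑ W ∈ U.powerset, ν W * chainMix ent ent' 1 c d W) *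
            (∑ W ∈ U.powerset, ν W * chainMix ent ent' 1 c d W * y W) *
            (∑ W ∈ U.powerset, ν W * chainMix ent ent' 1 c d' W * x W)
          - (∑ W ∈ U.powerset, ν W * chainMix ent ent' 1 c d W) *
            (∑ W ∈ U.powerset, ν W * chainMix ent ent' 1 c d W * x W) *
            (∑ W ∈ U.powerset, ν W * chainMix ent ent' 1 c d' W * y W)
          + (∑ W ∈ U.powerset, ν W * chainMix ent ent' 1 c d W * x W) *
            (∑ W ∈ U.powerset, ν W * chainMix ent ent' 1 c d W * y W) *
            (∑ W ∈ U.powerset, ν W * chainMix ent ent' 1 c d' W))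
        + ((∑ W ∈ U.powerset, ν W * chainMix ent ent' 1 c d W) -
            (∑ W ∈ U.powerset, ν W * chainMix ent ent' 1 c d' W)) *
          (((∑ W ∈ U.powerset, ν W * chainMix ent ent' 1 c d W) *
              (∑ W ∈ U.powerset, ν W * chainMix ent ent' 0 c d W * x W)
            - (∑ W ∈ U.powerset, ν W * chainMix ent ent' 0 c d W) *
              (∑ W ∈ U.powerset, ν W * chainMix ent ent' 1 c d W * x W)) *
           ((∑ W ∈ U.powerset, ν W * chainMix ent ent' 1 c d W) *
              (∑ W ∈ U.powerset, ν W * chainMix ent ent' 0 c d W * y W)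
            - (∑ W ∈ U.powerset, ν W * chainMix ent ent' 0 c d W) *
              (∑ W ∈ U.powerset, ν W * chainMix ent ent' 1 c d W * y W)))) :
    0 ≤ (∑ W ∈ U.powerset, ν W * chainMix ent ent' ρ c d W) ^ 2 *
          (∑ W ∈ U.powerset, ν W * chainMix ent ent' ρ c d' W * (x W * y W))
        - (∑ W ∈ U.powerset, ν W * chainMix ent ent' ρ c d W) *
          (∑ W ∈ U.powerset, ν W * chainMix ent ent' ρ c d W * x W) *
          (∑ W ∈ U.powerset, ν W * chainMix ent ent' ρ c d' W * y W)
        - (∑ W ∈ U.powerset, ν W * chainMix ent ent' ρ c d W) *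
          (∑ W ∈ U.powerset, ν W * chainMix ent ent' ρ c d W * y W) *
          (∑ W ∈ U.powerset, ν W * chainMix ent ent' ρ c d' W * x W)
        + (∑ W ∈ U.powerset, ν W * chainMix ent ent' ρ c d W * x W) *
          (∑ W ∈ U.powerset, ν W * chainMix ent ent' ρ c d W * y W) *
          (∑ W ∈ U.powerset, ν W * chainMix ent ent' ρ c d' W) := by
  -- the seven sums at `ρ` are affine in `ρ` (`chainMix_affine`)
  have hR : ∀ W, ν W * chainMix ent ent' ρ c d W =
      (1 - ρ) * (ν W * chainMix ent ent' 0 c d W) + ρ * (ν W * chainMix ent ent' 1 c d W) := by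
    intro W; rw [chainMix_affine ent ent' ρ c d W]; ring
  have hG : ∀ W, ν W * chainMix ent ent' ρ c d' W =
      (1 - ρ) * (ν W * chainMix ent ent' 0 c d' W) + ρ * (ν W * chainMix ent ent' 1 c d' W) := by
    intro W; rw [chainMix_affine ent ent' ρ c d' W]; ring
  have s0 : ∑ W ∈ U.powerset, ν W * chainMix ent ent' ρ c d W =
      (1 - ρ) * ∑ W ∈ U.powerset, ν W * chainMix ent ent' 0 c d W +
        ρ * ∑ W ∈ U.powerset, ν W * chainMix ent ent' 1 c d W := by
    rw [Finset.mul_sum, Finset.mul_sum, ← Finset.sum_add_distrib]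
    exact Finset.sum_congr rfl fun W _ => hR W
  have s1 : ∑ W ∈ U.powerset, ν W * chainMix ent ent' ρ c d W * x W =
      (1 - ρ) * ∑ W ∈ U.powerset, ν W * chainMix ent ent' 0 c d W * x W +
        ρ * ∑ W ∈ U.powerset, ν W * chainMix ent ent' 1 c d W * x W := by
    rw [Finset.mul_sum, Finset.mul_sum, ← Finset.sum_add_distrib]
    exact Finset.sum_congr rfl fun W _ => by rw [hR W]; ring
  have s2 : ∑ W ∈ U.powerset, ν W * chainMix ent ent' ρ c d W * y W =
      (1 - ρ) * ∑ W ∈ U.powerset, ν W * chainMix ent ent' 0 c d W * y W +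
        ρ * ∑ W ∈ U.powerset, ν W * chainMix ent ent' 1 c d W * y W := by
    rw [Finset.mul_sum, Finset.mul_sum, ← Finset.sum_add_distrib]
    exact Finset.sum_congr rfl fun W _ => by rw [hR W]; ring
  have g0 : ∑ W ∈ U.powerset, ν W * chainMix ent ent' ρ c d' W =
      (1 - ρ) * ∑ W ∈ U.powerset, ν W * chainMix ent ent' 0 c d' W +
        ρ * ∑ W ∈ U.powerset, ν W * chainMix ent ent' 1 c d' W := by
    rw [Finset.mul_sum, Finset.mul_sum, ← Finset.sum_add_distrib]
    exact Finset.sum_congr rfl fun W _ => hG W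
  have g1 : ∑ W ∈ U.powerset, ν W * chainMix ent ent' ρ c d' W * x W =
      (1 - ρ) * ∑ W ∈ U.powerset, ν W * chainMix ent ent' 0 c d' W * x W +
        ρ * ∑ W ∈ U.powerset, ν W * chainMix ent ent' 1 c d' W * x W := by
    rw [Finset.mul_sum, Finset.mul_sum, ← Finset.sum_add_distrib]
    exact Finset.sum_congr rfl fun W _ => by rw [hG W]; ring
  have g2 : ∑ W ∈ U.powerset, ν W * chainMix ent ent' ρ c d' W * y W =
      (1 - ρ) * ∑ W ∈ U.powerset, ν W * chainMix ent ent' 0 c d' W * y W +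
        ρ * ∑ W ∈ U.powerset, ν W * chainMix ent ent' 1 c d' W * y W := by
    rw [Finset.mul_sum, Finset.mul_sum, ← Finset.sum_add_distrib]
    exact Finset.sum_congr rfl fun W _ => by rw [hG W]; ring
  have g12 : ∑ W ∈ U.powerset, ν W * chainMix ent ent' ρ c d' W * (x W * y W) =
      (1 - ρ) * ∑ W ∈ U.powerset, ν W * chainMix ent ent' 0 c d' W * (x W * y W) +
        ρ * ∑ W ∈ U.powerset, ν W * chainMix ent ent' 1 c d' W * (x W * y W) := by
    rw [Finset.mul_sum, Finset.mul_sum, ← Finset.sum_add_distrib]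
    exact Finset.sum_congr rfl fun W _ => by rw [hG W]; ring
  rw [s0, s1, s2, g0, g1, g2, g12]
  -- the kernel mixed-centre functionals `U111`, `U000`
  have hU111 := chain_world1_mixed_nonneg U ent ent' ν c d d' 1 1 zero_le_one le_rfl zero_le_one
    le_rfl hν0 hν hc0 hd0 hd'0 hdc hd'c hcc hdd hd'd' hcd hcd' hdd' hratio hratio' x y hx0 hy0 hxm hym
  have hU000 := chain_world1_mixed_nonneg U ent ∅ ν c d d' 1 1 zero_le_one le_rfl zero_le_one
    le_rfl hν0 hν hc0 hd0 hd'0 hdc hd'c hcc hdd hd'd' hcd hcd' hdd' hratio hratio' x y hx0 hy0 hxm hym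
  simp only [← chainMix_zero_as_one_empty ent ent'] at hU000
  -- the masses: `e0 ≤ a0`, `b0 ≤ a0`, `a0 − e0 ≤ b0 − g0`
  have he0 : (∑ W ∈ U.powerset, ν W * chainMix ent ent' 0 c d' W) ≤
      ∑ W ∈ U.powerset, ν W * chainMix ent ent' 0 c d W :=
    Finset.sum_le_sum fun W _ =>
      mul_le_mul_of_nonneg_left (chainMix_le_of_le ent ent' le_rfl zero_le_one hd'd W) (hν0 W)
  have hba : (∑ W ∈ U.powerset, ν W * chainMix ent ent' 1 c d W) ≤
      ∑ W ∈ U.powerset, ν W * chainMix ent ent' 0 c d W :=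
    Finset.sum_le_sum fun W _ =>
      mul_le_mul_of_nonneg_left (chainMix_one_le_zero ent ent' hdc W) (hν0 W)
  have hP : (∑ W ∈ U.powerset, ν W * chainMix ent ent' 0 c d W) -
      (∑ W ∈ U.powerset, ν W * chainMix ent ent' 0 c d' W) ≤
      (∑ W ∈ U.powerset, ν W * chainMix ent ent' 1 c d W) -
      (∑ W ∈ U.powerset, ν W * chainMix ent ent' 1 c d' W) := by
    rw [← Finset.sum_sub_distrib, ← Finset.sum_sub_distrib]
    refine Finset.sum_le_sum fun W _ => ?_
    rw [← mul_sub, ← mul_sub]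
    exact mul_le_mul_of_nonneg_left (chainMix_sub_zero_le_one ent ent' hd'd W) (hν0 W)
  obtain ⟨h1, h2⟩ := chain_bernstein_of_XA_Qprime _ _ _ _ _ _ _ _ _ _ _ _ _ _ hpos0 hpos1 he0 hba hP
    hU000 hU111 hXA hQ
  exact chain_bernstein_nonneg _ _ _ _ _ _ _ _ _ _ _ _ _ _ ρ hρ0 hρ1 hU000 h1 h2 hU111

end XAChain

end Summit.Ventures.PercRepro2.Coin
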